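import Summits.BirchSwinnertonDyer.BirchSwinnertonDyer.Theorems.ThetaPartnerAtTwoSignedKatoUpToAtTwoSemilinearTransport
import Literature.NumberTheory.EllipticCurves.IwasawaAlgebraDivisibilityProofs
import HarnessLib

/-!
# Route `ThetaPartnerAtTwo` (TP2), crux K3 `SignedKatoDivisibilityUpToAtTwo` (item stmt-BirchSwinnertonDyer-20308),
# line `colemanrat` v5 — SEMILINEAR MAPS (not necessarily bijective): kernel, image, and
# `ℓ_𝔓(im f) = ℓ_𝔭(M ⧸ ker f)` at `𝔭 = σ⁻¹(𝔓)`

Width seat `bsd-wall-tp2-p2x-w3` g3 (cell `bsd-wall`). HONEST FRAMING: THEOREMS ONLY — pure commutative algebra, no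
definition, no named fact, no instance, no `sorry`; route-independent; closes no item; BSD is NOT proved by any of this.

## Why this file

Companion of `…SemilinearTransport` (semilinear ISOMORPHISMS). The K3 lead's skeleton `colemanrat` v5 (stub (R2^ι)
`stub_localRobustPackageTwoInv`) types the Poitou–Tate map of the Coleman package in the points model as an ADDITIVE,
`ι`-SEMILINEAR map `j : P →+ X⁺`, `j (g • y) = ι g • j y` (`ι` the Iwasawa involution) — print-exact per the
convention audit `Cruxes/SignedKatoDivisibilityUpToAtTwo/G4-CONVENTION-AUDIT.md`. The kernel stub CHAIN^ι
(`stub_involChainTwo`, v4's four-term road re-read with the twist) then needs, in the lead's words (bus 02:21:15Z),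
«lengthAt of an ι-semilinear image = lengthAt of the source quotient at `PrimeSpectrum.comap ι 𝔭`» — this file — and
«`ℓ_{ι𝔭}(Λ/(f)) = ℓ_𝔭(Λ/(ι f))`» — `…SemilinearTransport.lengthAt_quotient_span_singleton_eq`.

## What is proved (`σ : R ≃+* S`, `f : M →+ N` with `hf : ∀ r m, f (r • m) = σ r • f m`, `𝔭 = σ⁻¹(𝔓)`)

* `exists_semilinearMap` (`f` IS a Mathlib `M →ₛₗ[σ] N`), `exists_ker_submodule`, `exists_range_submodule`
  (kernel / image are submodules — delivered as `∃ K, ∀ m, m ∈ K ↔ f m = 0`, `∃ L, ∀ n, n ∈ L ↔ n ∈ range f`, so that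
  all statements below hold for ANY such `K`, `L`, in particular for the consumer's own `LinearMap.ker/range`);
* `exists_quotient_ker_equiv_range` — the first isomorphism theorem `M ⧸ K ≃+ L`, `σ`-semilinear, factoring `f`;
* **`lengthAt_quotient_ker_eq_lengthAt_range : lengthAt R (M ⧸ K) 𝔭 = lengthAt S L 𝔓`**;
* `lengthAt_range_le` (`ℓ_𝔓(im f) ≤ ℓ_𝔭(M)`), `lengthAt_quotient_ker_le` (`ℓ_𝔭(M ⧸ ker f) ≤ ℓ_𝔓(N)`).

References: [Bourbaki, Algèbre commutative VII §4.4]; [Washington1997, §13.2]; [GreenbergLNM1716, §1 (`X^ι`)].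
-/

set_option autoImplicit false
-- the Theorems namespace of this sub repeats the summit name by design (D-0017 nested layout)
set_option linter.dupNamespace false

noncomputable section

open scoped Classical

namespace Summit.BirchSwinnertonDyer.BirchSwinnertonDyer.Theorems

namespace SignedKatoOffTwo.SemilinearTransport

open Literature.NumberTheory.EllipticCurves Literature.NumberTheory.EllipticCurves.Module

universe u v w x

variable {R : Type u} {S : Type v} [CommRing R] [CommRing S] (σ : R ≃+* S)
  {M : Type w} {N : Type x} [AddCommGroup M] [Module R M] [AddCommGroup N] [Module S N]
  (f : M →+ N)

/-- An additive `σ`-semilinear map IS a Mathlib semilinear map `M →ₛₗ[σ] N` (the bare type needs no instance).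
[folklore] -/
theorem exists_semilinearMap (hf : ∀ (r : R) (m : M), f (r • m) = σ r • f m) :
    ∃ g : M →ₛₗ[(σ : R →+* S)] N, ∀ m, g m = f m :=
  ⟨{ toFun := f, map_add' := f.map_add, map_smul' := hf }, fun _ ↦ rfl⟩

/-- The kernel of a `σ`-semilinear additive map is an `R`-submodule. [folklore] -/
theorem exists_ker_submodule (hf : ∀ (r : R) (m : M), f (r • m) = σ r • f m) :
    ∃ K : Submodule R M, ∀ m, m ∈ K ↔ f m = 0 :=
  ⟨{ carrier := {m | f m = 0}
     add_mem' := fun {a b} ha hb ↦ by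
       simp only [Set.mem_setOf_eq, map_add] at ha hb ⊢
       rw [ha, hb, add_zero]
     zero_mem' := by simp
     smul_mem' := fun r m hm ↦ by
       simp only [Set.mem_setOf_eq] at hm ⊢
       rw [hf, hm, smul_zero] }, fun _ ↦ Iff.rfl⟩

/-- The image of a `σ`-semilinear additive map (`σ` a ring ISOMORPHISM) is an `S`-submodule. [folklore] -/
theorem exists_range_submodule (hf : ∀ (r : R) (m : M), f (r • m) = σ r • f m) :
    ∃ L : Submodule S N, ∀ n, n ∈ L ↔ n ∈ Set.range f :=
  ⟨{ carrier := Set.range f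
     add_mem' := by
       rintro _ _ ⟨a, rfl⟩ ⟨b, rfl⟩
       exact ⟨a + b, map_add f a b⟩
     zero_mem' := ⟨0, map_zero f⟩
     smul_mem' := by
       rintro s _ ⟨m, rfl⟩
       exact ⟨σ.symm s • m, by rw [hf, σ.apply_symm_apply]⟩ }, fun _ ↦ Iff.rfl⟩

variable {σ f} {𝔭 : PrimeSpectrum R} {𝔓 : PrimeSpectrum S}

/-- **The first isomorphism theorem, semilinear and additive**: for a `σ`-semilinear additive `f`, any `R`-submodule
`K` with carrier `ker f` and any `S`-submodule `L` with carrier `im f`, there is a `σ`-semilinear additive isomorphism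
`M ⧸ K ≃+ L` through which `f` factors. [folklore] -/
theorem exists_quotient_ker_equiv_range (hf : ∀ (r : R) (m : M), f (r • m) = σ r • f m)
    (K : Submodule R M) (hK : ∀ m, m ∈ K ↔ f m = 0) (L : Submodule S N)
    (hL : ∀ n, n ∈ L ↔ n ∈ Set.range f) :
    ∃ Φ : (M ⧸ K) ≃+ L,
      (∀ (r : R) (x : M ⧸ K), Φ (r • x) = σ r • Φ x) ∧
      ∀ m : M, (Φ (Submodule.Quotient.mk m) : N) = f m := by
  let g : M →ₛₗ[(σ : R →+* S)] L :=
    { toFun := fun m ↦ ⟨f m, (hL _).2 ⟨m, rfl⟩⟩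
      map_add' := fun a b ↦ Subtype.ext (by simp [map_add])
      map_smul' := fun r m ↦ Subtype.ext (by simp [hf]) }
  have hg : ∀ m, (g m : N) = f m := fun _ ↦ rfl
  have hKg : K ≤ LinearMap.ker g := fun m hm ↦ by
    rw [LinearMap.mem_ker]
    exact Subtype.ext ((hg m).trans ((hK m).1 hm))
  let q : M ⧸ K →ₛₗ[(σ : R →+* S)] L := K.liftQ g hKg
  have hq : ∀ m, q (Submodule.Quotient.mk m) = g m := fun m ↦ Submodule.liftQ_apply K g m
  have hq_inj : Function.Injective q := by
    rw [injective_iff_map_eq_zero]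
    intro x hx
    obtain ⟨m, rfl⟩ := Submodule.Quotient.mk_surjective K x
    rw [hq] at hx
    have hfm : f m = 0 := by rw [← hg m, hx]; rfl
    exact (Submodule.Quotient.mk_eq_zero K).2 ((hK m).2 hfm)
  have hq_surj : Function.Surjective q := by
    rintro ⟨n, hn⟩
    obtain ⟨m, rfl⟩ := (hL n).1 hn
    exact ⟨Submodule.Quotient.mk m, by rw [hq]; rfl⟩
  refine ⟨AddEquiv.ofBijective q.toAddMonoidHom ⟨hq_inj, hq_surj⟩, fun r x ↦ q.map_smulₛₗ r x, fun m ↦ ?_⟩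
  change ((q (Submodule.Quotient.mk m) : L) : N) = f m
  rw [hq, hg]

/-- **`ℓ_𝔭(M ⧸ ker f) = ℓ_𝔓(im f)`** for a `σ`-semilinear additive map `f` and `𝔭 = σ⁻¹(𝔓)` — for ANY `R`-submodule
`K` with carrier `ker f` and ANY `S`-submodule `L` with carrier `im f`. [folklore] -/
theorem lengthAt_quotient_ker_eq_lengthAt_range (hf : ∀ (r : R) (m : M), f (r • m) = σ r • f m)
    (K : Submodule R M) (hK : ∀ m, m ∈ K ↔ f m = 0) (L : Submodule S N)
    (hL : ∀ n, n ∈ L ↔ n ∈ Set.range f) (h𝔭 : 𝔭.asIdeal = 𝔓.asIdeal.comap σ) :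
    lengthAt R (M ⧸ K) 𝔭 = lengthAt S L 𝔓 := by
  obtain ⟨Φ, hΦ, -⟩ := exists_quotient_ker_equiv_range hf K hK L hL
  exact lengthAt_eq σ Φ hΦ h𝔭

/-- **`ℓ_𝔓(im f) ≤ ℓ_𝔭(M)`** for a `σ`-semilinear additive map `f` (`𝔭 = σ⁻¹(𝔓)`). [folklore] -/
theorem lengthAt_range_le (hf : ∀ (r : R) (m : M), f (r • m) = σ r • f m)
    (L : Submodule S N) (hL : ∀ n, n ∈ L ↔ n ∈ Set.range f) (h𝔭 : 𝔭.asIdeal = 𝔓.asIdeal.comap σ) :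
    lengthAt S L 𝔓 ≤ lengthAt R M 𝔭 := by
  obtain ⟨K, hK⟩ := exists_ker_submodule σ f hf
  rw [← lengthAt_quotient_ker_eq_lengthAt_range hf K hK L hL h𝔭]
  exact lengthAt_quotient_le K 𝔭

/-- **`ℓ_𝔭(M ⧸ ker f) ≤ ℓ_𝔓(N)`** for a `σ`-semilinear additive map `f` (`𝔭 = σ⁻¹(𝔓)`). [folklore] -/
theorem lengthAt_quotient_ker_le (hf : ∀ (r : R) (m : M), f (r • m) = σ r • f m)
    (K : Submodule R M) (hK : ∀ m, m ∈ K ↔ f m = 0) (h𝔭 : 𝔭.asIdeal = 𝔓.asIdeal.comap σ) :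
    lengthAt R (M ⧸ K) 𝔭 ≤ lengthAt S N 𝔓 := by
  obtain ⟨L, hL⟩ := exists_range_submodule σ f hf
  rw [lengthAt_quotient_ker_eq_lengthAt_range hf K hK L hL h𝔭]
  exact lengthAt_submodule_le L 𝔓

/-- **Injective semilinear maps do not increase local length**: `ℓ_𝔭(M) ≤ ℓ_𝔓(N)` for an injective `σ`-semilinear
additive `f` (`𝔭 = σ⁻¹(𝔓)`). [folklore] -/
theorem lengthAt_le_of_injective (hf : ∀ (r : R) (m : M), f (r • m) = σ r • f m)
    (hinj : Function.Injective f) (h𝔭 : 𝔭.asIdeal = 𝔓.asIdeal.comap σ) :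
    lengthAt R M 𝔭 ≤ lengthAt S N 𝔓 := by
  have hK : ∀ m, m ∈ (⊥ : Submodule R M) ↔ f m = 0 := fun m ↦ by
    rw [Submodule.mem_bot, ← map_eq_zero_iff f hinj]
  have h := lengthAt_quotient_ker_le hf ⊥ hK h𝔭
  rwa [lengthAt_eq_of_linearEquiv (Submodule.quotEquivOfEqBot ⊥ rfl) 𝔭] at h

end SignedKatoOffTwo.SemilinearTransport

end Summit.BirchSwinnertonDyer.BirchSwinnertonDyer.Theorems

end
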